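import Summits.HubbardSuperconductivity.HubbardSuperconductivity.Theorems.AnisotropyChordSpinBlowUpDefs
import Literature.MathematicalPhysics.QuantumLattice.SpinChainsLiebMattisProofs

/-!
# Route `AnisotropyChord`: the copy blow-up — LADDER INTERTWINING
# (`(Σ_i S^±_{(x,i)}) J = J S^±_x`, `(Σ_i Sᶻ_{(x,i)}) J = J Sᶻ_x`; theory seat memo ROTOR-THEORY-6 §72)

For the symmetrisation isometry `J = blowUpIso n` of `…SpinBlowUpDefs` (sitewise Dicke states), the
fibre sums of the spin-½ ladder operators of the copies of a site act on `range J` as the spin-`n/2`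
ladder operators of that site:

* `blowUpCount_update_one_val`, `blowUpCount_update_zero_val`, `card_filter_copies_zero` — copy counts
  under single-copy updates;
* `sum_spinRaise_one_mul`, `sum_spinLower_one_mul` — the spin-½ ladder matrices have one entry;
* `ladder_ratio`, `ladder_ratio'` — the binomial identity `C(n,c+1)(c+1) = C(n,c)(n−c)` in the
  square-root form that matches the Dicke normalisations with the spin-`n/2` matrix elements
  `√((c+1)(n−c))`;
* `fibreRaise_mul_blowUpIso`, `fibreLower_mul_blowUpIso`, `fibreZ_mul_blowUpIso` — the three
  intertwining identities (entrywise computation: `n − c_x` vanishing copies can be raised, each landing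
  in the fibre of `c + e_x`, etc.).

Theory seat `hubbard-h0-rotor-theory-1` (memo ROTOR-THEORY-6 §72); H. Tasaki, *Physics and Mathematics
of Quantum Many-Body Systems* (2020) §2.1 (spin `S` from `2S` spins ½).  No definition is introduced.
-/

set_option linter.dupNamespace false

noncomputable section

namespace Summit.HubbardSuperconductivity.HubbardSuperconductivity.Theorems.AnisotropyChord

open Matrix Complex Finset
open Literature.MathematicalPhysics.QuantumLattice

variable {V : Type} [Fintype V] [DecidableEq V]

/-! ### Copy counts under single-copy updates -/

omit [Fintype V] in
/-- Raising one copy from `0` to `1` raises the count at that site by one and leaves the others. [folklore] -/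
theorem blowUpCount_update_one_val (n : ℕ) (τ : V × Fin n → Fin 2) (x : V) (i : Fin n)
    (hi : τ (x, i) = 0) (y : V) :
    ((blowUpCount n (Function.update τ (x, i) 1) y : Fin (n + 1)) : ℕ) =
      if y = x then (blowUpCount n τ x : ℕ) + 1 else (blowUpCount n τ y : ℕ) := by
  simp only [blowUpCount_apply_val]
  by_cases hy : y = x
  · subst hy
    rw [if_pos rfl]
    have hset : (Finset.univ.filter fun j : Fin n => Function.update τ (y, i) 1 (y, j) = 1) =
        insert i (Finset.univ.filter fun j : Fin n => τ (y, j) = 1) := by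
      ext j
      simp only [Finset.mem_filter, Finset.mem_univ, true_and, Finset.mem_insert]
      by_cases hj : j = i
      · subst hj; simp
      · rw [Function.update_of_ne (fun h => hj (Prod.mk.inj h).2)]
        simp [hj]
    rw [hset, Finset.card_insert_of_notMem]
    simp [hi]
  · rw [if_neg hy]
    congr 1
    ext j
    simp only [Finset.mem_filter, Finset.mem_univ, true_and]
    rw [Function.update_of_ne (fun h => hy (Prod.mk.inj h).1)]

omit [Fintype V] in
/-- Lowering one copy from `1` to `0` lowers the count at that site by one and leaves the others. [folklore] -/
theorem blowUpCount_update_zero_val (n : ℕ) (τ : V × Fin n → Fin 2) (x : V) (i : Fin n)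
    (hi : τ (x, i) = 1) (y : V) :
    ((blowUpCount n (Function.update τ (x, i) 0) y : Fin (n + 1)) : ℕ) + (if y = x then 1 else 0) =
      (blowUpCount n τ y : ℕ) := by
  simp only [blowUpCount_apply_val]
  by_cases hy : y = x
  · subst hy
    rw [if_pos rfl]
    have hset : insert i (Finset.univ.filter fun j : Fin n => Function.update τ (y, i) 0 (y, j) = 1) =
        (Finset.univ.filter fun j : Fin n => τ (y, j) = 1) := by
      ext j
      simp only [Finset.mem_filter, Finset.mem_univ, true_and, Finset.mem_insert]
      by_cases hj : j = i
      · subst hj; simp [hi]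
      · rw [Function.update_of_ne (fun h => hj (Prod.mk.inj h).2)]
        simp [hj]
    rw [← hset, Finset.card_insert_of_notMem]
    simp
  · rw [if_neg hy, add_zero]
    congr 1
    ext j
    simp only [Finset.mem_filter, Finset.mem_univ, true_and]
    rw [Function.update_of_ne (fun h => hy (Prod.mk.inj h).1)]

omit [Fintype V] [DecidableEq V] in
/-- The number of copies at `x` with value `0` is `n − k_x`. [folklore] -/
theorem card_filter_copies_zero (n : ℕ) (τ : V × Fin n → Fin 2) (x : V) :
    (Finset.univ.filter fun i : Fin n => τ (x, i) = 0).card = n - (blowUpCount n τ x : ℕ) := by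
  rw [blowUpCount_apply_val]
  have h : (Finset.univ.filter fun i : Fin n => τ (x, i) = 0) =
      (Finset.univ.filter fun i : Fin n => τ (x, i) = 1)ᶜ := by
    ext i
    simp only [Finset.mem_filter, Finset.mem_univ, true_and, Finset.mem_compl]
    constructor
    · intro h0 h1; rw [h0] at h1; exact absurd h1 (by decide)
    · intro h1
      rcases Fin.exists_fin_two.mp ⟨τ (x, i), rfl⟩ with h | h
      · exact h
      · exact absurd h h1
  rw [h, Finset.card_compl, Fintype.card_fin]

/-! ### Single-copy spin-½ ladder sums -/

/-- `Σ_l S⁺_{½}(a, l) f(l) = [a = 0] f(1)` (the only entry of the spin-½ raising matrix is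
`⟨0|S⁺|1⟩ = 1`). [folklore] -/
theorem sum_spinRaise_one_mul (a : Fin 2) (f : Fin 2 → ℂ) :
    (∑ l : Fin 2, spinRaise 1 a l * f l) = if a = 0 then f 1 else 0 := by
  fin_cases a <;> simp [Fin.sum_univ_two, spinRaise_apply]

/-- `Σ_l S⁻_{½}(a, l) f(l) = [a = 1] f(0)`. [folklore] -/
theorem sum_spinLower_one_mul (a : Fin 2) (f : Fin 2 → ℂ) :
    (∑ l : Fin 2, spinLower 1 a l * f l) = if a = 1 then f 0 else 0 := by
  fin_cases a <;> simp [spinLower_apply]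

/-! ### The binomial ratio behind the ladder intertwining -/

/-- `(n − c) / √(C(n,c+1) R) = √((c+1)(n−c)) / √(C(n,c) R)` for `c < n`, `R > 0`
(from `C(n,c+1)(c+1) = C(n,c)(n−c)`). [folklore] -/
theorem ladder_ratio {n c : ℕ} (hc : c < n) {R : ℝ} (hR : 0 < R) :
    ((n : ℝ) - c) * (Real.sqrt ((n.choose (c + 1) : ℝ) * R))⁻¹ =
      (Real.sqrt ((n.choose c : ℝ) * R))⁻¹ * Real.sqrt (((c : ℝ) + 1) * ((n : ℝ) - c)) := by
  have hnc : (0 : ℝ) < (n : ℝ) - c := by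
    have : (c : ℝ) < n := by exact_mod_cast hc
    linarith
  have hC1 : (0 : ℝ) < (n.choose (c + 1) : ℝ) := by exact_mod_cast Nat.choose_pos hc
  have hC0 : (0 : ℝ) < (n.choose c : ℝ) := by exact_mod_cast Nat.choose_pos hc.le
  have hkey : ((n.choose (c + 1) : ℝ)) * ((c : ℝ) + 1) = (n.choose c : ℝ) * ((n : ℝ) - c) := by
    have h := Nat.choose_succ_right_eq n c
    have h' : ((n.choose (c + 1) * (c + 1) : ℕ) : ℝ) = ((n.choose c * (n - c) : ℕ) : ℝ) := by rw [h]
    push_cast at h'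
    rw [Nat.cast_sub hc.le] at h'
    exact h'
  have hL : 0 ≤ ((n : ℝ) - c) * (Real.sqrt ((n.choose (c + 1) : ℝ) * R))⁻¹ :=
    mul_nonneg hnc.le (inv_nonneg.mpr (Real.sqrt_nonneg _))
  have hRt : 0 ≤ (Real.sqrt ((n.choose c : ℝ) * R))⁻¹ * Real.sqrt (((c : ℝ) + 1) * ((n : ℝ) - c)) :=
    mul_nonneg (inv_nonneg.mpr (Real.sqrt_nonneg _)) (Real.sqrt_nonneg _)
  refine (pow_left_inj₀ hL hRt two_ne_zero).mp ?_
  rw [mul_pow, mul_pow, inv_pow, inv_pow, Real.sq_sqrt (by positivity), Real.sq_sqrt (by positivity),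
    Real.sq_sqrt (by positivity)]
  field_simp
  nlinarith [hkey]

/-- Transposed form: `(c+1) / √(C(n,c) R) = √((c+1)(n−c)) / √(C(n,c+1) R)` for `c < n`, `R > 0`.
[folklore] -/
theorem ladder_ratio' {n c : ℕ} (hc : c < n) {R : ℝ} (hR : 0 < R) :
    (((c : ℝ) + 1)) * (Real.sqrt ((n.choose c : ℝ) * R))⁻¹ =
      (Real.sqrt ((n.choose (c + 1) : ℝ) * R))⁻¹ * Real.sqrt (((c : ℝ) + 1) * ((n : ℝ) - c)) := by
  have hnc : (0 : ℝ) < (n : ℝ) - c := by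
    have : (c : ℝ) < n := by exact_mod_cast hc
    linarith
  have hC1 : (0 : ℝ) < (n.choose (c + 1) : ℝ) := by exact_mod_cast Nat.choose_pos hc
  have hC0 : (0 : ℝ) < (n.choose c : ℝ) := by exact_mod_cast Nat.choose_pos hc.le
  have hkey : ((n.choose (c + 1) : ℝ)) * ((c : ℝ) + 1) = (n.choose c : ℝ) * ((n : ℝ) - c) := by
    have h := Nat.choose_succ_right_eq n c
    have h' : ((n.choose (c + 1) * (c + 1) : ℕ) : ℝ) = ((n.choose c * (n - c) : ℕ) : ℝ) := by rw [h]
    push_cast at h'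
    rw [Nat.cast_sub hc.le] at h'
    exact h'
  have hL : 0 ≤ (((c : ℝ) + 1)) * (Real.sqrt ((n.choose c : ℝ) * R))⁻¹ :=
    mul_nonneg (by positivity) (inv_nonneg.mpr (Real.sqrt_nonneg _))
  have hRt : 0 ≤ (Real.sqrt ((n.choose (c + 1) : ℝ) * R))⁻¹ * Real.sqrt (((c : ℝ) + 1) * ((n : ℝ) - c)) :=
    mul_nonneg (inv_nonneg.mpr (Real.sqrt_nonneg _)) (Real.sqrt_nonneg _)
  refine (pow_left_inj₀ hL hRt two_ne_zero).mp ?_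
  rw [mul_pow, mul_pow, inv_pow, inv_pow, Real.sq_sqrt (by positivity), Real.sq_sqrt (by positivity),
    Real.sq_sqrt (by positivity)]
  field_simp
  nlinarith [hkey]

/-! ### Ladder intertwining: the fibre raising / lowering / `Sᶻ` operators -/

/-- **Raising intertwines:** `(Σ_i S⁺_{(x,i)}) J = J S⁺_x` — the fibre sum of spin-½ raising
operators acts on the symmetrised states as the spin-`n/2` raising operator.
Theory seat memo ROTOR-THEORY-6 §72; Tasaki (2020) §2.1. [folklore] -/
theorem fibreRaise_mul_blowUpIso (n : ℕ) (x : V) :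
    ((∑ i : Fin n, (onSite (x, i) (spinRaise 1) : Matrix (V × Fin n → Fin 2) (V × Fin n → Fin 2) ℂ)) * (blowUpIso n : Matrix (V × Fin n → Fin 2) (V → Fin (n + 1)) ℂ) : Matrix (V × Fin n → Fin 2) (V → Fin (n + 1)) ℂ) =
      ((blowUpIso n : Matrix (V × Fin n → Fin 2) (V → Fin (n + 1)) ℂ) * (onSite x (spinRaise n) : Matrix (V → Fin (n + 1)) (V → Fin (n + 1)) ℂ) : Matrix (V × Fin n → Fin 2) (V → Fin (n + 1)) ℂ) := by
  ext τ k
  rw [Matrix.sum_mul, Matrix.sum_apply]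
  -- left: each copy contributes `[τ(x,i) = 0] · J(τ with (x,i) ↦ 1, k)`
  have hL : ∀ i : Fin n, ((onSite (x, i) (spinRaise 1) : Matrix (V × Fin n → Fin 2) (V × Fin n → Fin 2) ℂ) * (blowUpIso n : Matrix (V × Fin n → Fin 2) (V → Fin (n + 1)) ℂ) : Matrix (V × Fin n → Fin 2) (V → Fin (n + 1)) ℂ) τ k =
      if τ (x, i) = 0 then blowUpIso n (Function.update τ (x, i) 1) k else 0 := by
    intro i
    have e : ((onSite (x, i) (spinRaise 1) : Matrix (V × Fin n → Fin 2) (V × Fin n → Fin 2) ℂ) * (blowUpIso n : Matrix (V × Fin n → Fin 2) (V → Fin (n + 1)) ℂ) : Matrix (V × Fin n → Fin 2) (V → Fin (n + 1)) ℂ) τ k =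
        ((onSite (x, i) (spinRaise 1) : Matrix (V × Fin n → Fin 2) (V × Fin n → Fin 2) ℂ) *ᵥ fun τ' => blowUpIso n τ' k) τ := by
      rw [Matrix.mul_apply, Matrix.mulVec, dotProduct]
    rw [e, LiebMattis.onSite_mulVec_apply, sum_spinRaise_one_mul]
  simp_rw [hL]
  -- right: `N(c)^{-1/2} · ⟨c| S⁺_x |k⟩`, `c = blowUpCount τ`
  set c := blowUpCount n τ with hc
  have hR : ((blowUpIso n : Matrix (V × Fin n → Fin 2) (V → Fin (n + 1)) ℂ) * (onSite x (spinRaise n) : Matrix (V → Fin (n + 1)) (V → Fin (n + 1)) ℂ) : Matrix (V × Fin n → Fin 2) (V → Fin (n + 1)) ℂ) τ k =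
      (((Real.sqrt (blowUpFibreCard n c))⁻¹ : ℝ) : ℂ) *
        (if (∀ y, y ≠ x → c y = k y) then spinRaise n (c x) (k x) else 0) := by
    rw [Matrix.mul_apply, Finset.sum_eq_single c]
    · rw [blowUpIso_apply, if_pos hc.symm, onSite_apply]
    · intro k' _ hk'
      rw [blowUpIso_apply, if_neg (fun h => hk' (h.symm.trans hc.symm)), zero_mul]
    · intro h; exact absurd (Finset.mem_univ _) h
  rw [hR]
  -- the predicate `P`: `k` agrees with `c` off `x` and `k_x = c_x + 1`
  by_cases hP : (∀ y, y ≠ x → c y = k y) ∧ (k x : ℕ) = (c x : ℕ) + 1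
  · obtain ⟨hoff, hx⟩ := hP
    -- every vanishing copy gives the same value
    have hval : ∀ i : Fin n, τ (x, i) = 0 →
        blowUpIso n (Function.update τ (x, i) 1) k = (((Real.sqrt (blowUpFibreCard n k))⁻¹ : ℝ) : ℂ) := by
      intro i hi
      rw [blowUpIso_apply, if_pos]
      funext y
      apply Fin.ext
      rw [blowUpCount_update_one_val n τ x i hi y]
      by_cases hy : y = x
      · subst hy; rw [if_pos rfl, ← hc, hx]
      · rw [if_neg hy, ← hc, hoff y hy]
    have hsum : (∑ i : Fin n, if τ (x, i) = 0 then blowUpIso n (Function.update τ (x, i) 1) k else 0) =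
        ((((n : ℝ) - ((c x : ℕ) : ℝ)) * (Real.sqrt (blowUpFibreCard n k))⁻¹ : ℝ) : ℂ) := by
      rw [← Finset.sum_filter, Finset.sum_congr rfl (fun i hi => hval i (Finset.mem_filter.1 hi).2),
        Finset.sum_const, nsmul_eq_mul, card_filter_copies_zero, ← hc, Complex.ofReal_mul]
      have hle : (c x : ℕ) ≤ n := Nat.le_of_lt_succ (c x).isLt
      push_cast [Nat.cast_sub hle]
      ring
    rw [hsum, if_pos hoff, spinRaise_apply, if_pos hx]
    -- the binomial ratio
    have hcx : (c x : ℕ) < n := by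
      have := (k x).isLt
      omega
    have hNk : blowUpFibreCard n k = (n.choose ((c x : ℕ) + 1) : ℝ) *
        ∏ y ∈ Finset.univ.erase x, (n.choose (c y : ℕ) : ℝ) := by
      rw [blowUpFibreCard_eq, ← Finset.mul_prod_erase _ _ (Finset.mem_univ x), hx]
      congr 1
      exact Finset.prod_congr rfl fun y hy => by rw [hoff y (Finset.ne_of_mem_erase hy)]
    have hNc : blowUpFibreCard n c = (n.choose (c x : ℕ) : ℝ) *
        ∏ y ∈ Finset.univ.erase x, (n.choose (c y : ℕ) : ℝ) := by
      rw [blowUpFibreCard_eq, ← Finset.mul_prod_erase _ _ (Finset.mem_univ x)]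
    have hRpos : 0 < ∏ y ∈ Finset.univ.erase x, (n.choose (c y : ℕ) : ℝ) :=
      Finset.prod_pos fun y _ => by exact_mod_cast Nat.choose_pos (Nat.le_of_lt_succ (c y).isLt)
    have hreal : ((n : ℝ) - ((c x : ℕ) : ℝ)) * (Real.sqrt (blowUpFibreCard n k))⁻¹ =
        (Real.sqrt (blowUpFibreCard n c))⁻¹ *
          Real.sqrt ((((c x : ℕ) : ℝ) + 1) * ((n : ℝ) - ((c x : ℕ) : ℝ))) := by
      rw [hNk, hNc]; exact ladder_ratio hcx hRpos
    rw [hreal, Complex.ofReal_mul]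
  · -- both sides vanish
    have hL0 : (∑ i : Fin n, if τ (x, i) = 0 then blowUpIso n (Function.update τ (x, i) 1) k else 0) = 0 := by
      refine Finset.sum_eq_zero fun i _ => ?_
      by_cases hi : τ (x, i) = 0
      · rw [if_pos hi, blowUpIso_apply, if_neg]
        intro hk
        apply hP
        constructor
        · intro y hy
          have h1 : ((blowUpCount n (Function.update τ (x, i) 1) y : Fin (n + 1)) : ℕ) = (k y : ℕ) := by
            rw [hk]
          rw [blowUpCount_update_one_val n τ x i hi y, if_neg hy] at h1
          exact Fin.ext h1
        · have h1 : ((blowUpCount n (Function.update τ (x, i) 1) x : Fin (n + 1)) : ℕ) = (k x : ℕ) := by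
            rw [hk]
          rw [blowUpCount_update_one_val n τ x i hi x, if_pos rfl] at h1
          rw [← h1]
      · rw [if_neg hi]
    rw [hL0]
    by_cases hoff : ∀ y, y ≠ x → c y = k y
    · have hx : ¬ ((k x : ℕ) = (c x : ℕ) + 1) := fun h => hP ⟨hoff, h⟩
      rw [if_pos hoff, spinRaise_apply, if_neg hx, mul_zero]
    · rw [if_neg hoff, mul_zero]

/-- **Lowering intertwines:** `(Σ_i S⁻_{(x,i)}) J = J S⁻_x`. Theory seat memo ROTOR-THEORY-6 §72;
Tasaki (2020) §2.1. [folklore] -/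
theorem fibreLower_mul_blowUpIso (n : ℕ) (x : V) :
    ((∑ i : Fin n, (onSite (x, i) (spinLower 1) : Matrix (V × Fin n → Fin 2) (V × Fin n → Fin 2) ℂ)) * (blowUpIso n : Matrix (V × Fin n → Fin 2) (V → Fin (n + 1)) ℂ) : Matrix (V × Fin n → Fin 2) (V → Fin (n + 1)) ℂ) =
      ((blowUpIso n : Matrix (V × Fin n → Fin 2) (V → Fin (n + 1)) ℂ) * (onSite x (spinLower n) : Matrix (V → Fin (n + 1)) (V → Fin (n + 1)) ℂ) : Matrix (V × Fin n → Fin 2) (V → Fin (n + 1)) ℂ) := by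
  ext τ k
  rw [Matrix.sum_mul, Matrix.sum_apply]
  have hL : ∀ i : Fin n, ((onSite (x, i) (spinLower 1) : Matrix (V × Fin n → Fin 2) (V × Fin n → Fin 2) ℂ) * (blowUpIso n : Matrix (V × Fin n → Fin 2) (V → Fin (n + 1)) ℂ) : Matrix (V × Fin n → Fin 2) (V → Fin (n + 1)) ℂ) τ k =
      if τ (x, i) = 1 then blowUpIso n (Function.update τ (x, i) 0) k else 0 := by
    intro i
    have e : ((onSite (x, i) (spinLower 1) : Matrix (V × Fin n → Fin 2) (V × Fin n → Fin 2) ℂ) * (blowUpIso n : Matrix (V × Fin n → Fin 2) (V → Fin (n + 1)) ℂ) : Matrix (V × Fin n → Fin 2) (V → Fin (n + 1)) ℂ) τ k =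
        ((onSite (x, i) (spinLower 1) : Matrix (V × Fin n → Fin 2) (V × Fin n → Fin 2) ℂ) *ᵥ fun τ' => blowUpIso n τ' k) τ := by
      rw [Matrix.mul_apply, Matrix.mulVec, dotProduct]
    rw [e, LiebMattis.onSite_mulVec_apply, sum_spinLower_one_mul]
  simp_rw [hL]
  set c := blowUpCount n τ with hc
  have hR : ((blowUpIso n : Matrix (V × Fin n → Fin 2) (V → Fin (n + 1)) ℂ) * (onSite x (spinLower n) : Matrix (V → Fin (n + 1)) (V → Fin (n + 1)) ℂ) : Matrix (V × Fin n → Fin 2) (V → Fin (n + 1)) ℂ) τ k =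
      (((Real.sqrt (blowUpFibreCard n c))⁻¹ : ℝ) : ℂ) *
        (if (∀ y, y ≠ x → c y = k y) then spinLower n (c x) (k x) else 0) := by
    rw [Matrix.mul_apply, Finset.sum_eq_single c]
    · rw [blowUpIso_apply, if_pos hc.symm, onSite_apply]
    · intro k' _ hk'
      rw [blowUpIso_apply, if_neg (fun h => hk' (h.symm.trans hc.symm)), zero_mul]
    · intro h; exact absurd (Finset.mem_univ _) h
  rw [hR]
  -- predicate: `k` agrees with `c` off `x` and `c_x = k_x + 1`
  by_cases hP : (∀ y, y ≠ x → c y = k y) ∧ (c x : ℕ) = (k x : ℕ) + 1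
  · obtain ⟨hoff, hx⟩ := hP
    have hval : ∀ i : Fin n, τ (x, i) = 1 →
        blowUpIso n (Function.update τ (x, i) 0) k = (((Real.sqrt (blowUpFibreCard n k))⁻¹ : ℝ) : ℂ) := by
      intro i hi
      rw [blowUpIso_apply, if_pos]
      funext y
      apply Fin.ext
      have h := blowUpCount_update_zero_val n τ x i hi y
      by_cases hy : y = x
      · subst hy; rw [if_pos rfl, ← hc, hx] at h; omega
      · rw [if_neg hy, add_zero, ← hc, hoff y hy] at h; exact h
    have hsum : (∑ i : Fin n, if τ (x, i) = 1 then blowUpIso n (Function.update τ (x, i) 0) k else 0) =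
        ((((c x : ℕ) : ℝ) * (Real.sqrt (blowUpFibreCard n k))⁻¹ : ℝ) : ℂ) := by
      rw [← Finset.sum_filter, Finset.sum_congr rfl (fun i hi => hval i (Finset.mem_filter.1 hi).2),
        Finset.sum_const, nsmul_eq_mul, ← blowUpCount_apply_val, ← hc, Complex.ofReal_mul]
      push_cast
      ring
    rw [hsum, if_pos hoff, spinLower_apply, if_pos hx]
    have hkx : (k x : ℕ) < n := by
      have := (c x).isLt
      omega
    have hNk : blowUpFibreCard n k = (n.choose (k x : ℕ) : ℝ) *
        ∏ y ∈ Finset.univ.erase x, (n.choose (c y : ℕ) : ℝ) := by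
      rw [blowUpFibreCard_eq, ← Finset.mul_prod_erase _ _ (Finset.mem_univ x)]
      congr 1
      exact Finset.prod_congr rfl fun y hy => by rw [hoff y (Finset.ne_of_mem_erase hy)]
    have hNc : blowUpFibreCard n c = (n.choose ((k x : ℕ) + 1) : ℝ) *
        ∏ y ∈ Finset.univ.erase x, (n.choose (c y : ℕ) : ℝ) := by
      rw [blowUpFibreCard_eq, ← Finset.mul_prod_erase _ _ (Finset.mem_univ x), hx]
    have hRpos : 0 < ∏ y ∈ Finset.univ.erase x, (n.choose (c y : ℕ) : ℝ) :=
      Finset.prod_pos fun y _ => by exact_mod_cast Nat.choose_pos (Nat.le_of_lt_succ (c y).isLt)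
    have hreal : (((c x : ℕ) : ℝ)) * (Real.sqrt (blowUpFibreCard n k))⁻¹ =
        (Real.sqrt (blowUpFibreCard n c))⁻¹ *
          Real.sqrt ((((k x : ℕ) : ℝ) + 1) * ((n : ℝ) - ((k x : ℕ) : ℝ))) := by
      rw [hNk, hNc, hx]
      push_cast
      exact ladder_ratio' hkx hRpos
    rw [hreal, Complex.ofReal_mul]
  · have hL0 : (∑ i : Fin n, if τ (x, i) = 1 then blowUpIso n (Function.update τ (x, i) 0) k else 0) = 0 := by
      refine Finset.sum_eq_zero fun i _ => ?_
      by_cases hi : τ (x, i) = 1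
      · rw [if_pos hi, blowUpIso_apply, if_neg]
        intro hk
        apply hP
        constructor
        · intro y hy
          have h := blowUpCount_update_zero_val n τ x i hi y
          rw [hk, if_neg hy, add_zero] at h
          exact Fin.ext h.symm
        · have h := blowUpCount_update_zero_val n τ x i hi x
          rw [hk, if_pos rfl] at h
          exact h.symm
      · rw [if_neg hi]
    rw [hL0]
    by_cases hoff : ∀ y, y ≠ x → c y = k y
    · have hx : ¬ ((c x : ℕ) = (k x : ℕ) + 1) := fun h => hP ⟨hoff, h⟩
      rw [if_pos hoff, spinLower_apply, if_neg hx, mul_zero]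
    · rw [if_neg hoff, mul_zero]

/-- **`Sᶻ` intertwines:** `(Σ_i Sᶻ_{(x,i)}) J = J Sᶻ_x` (`Σ_i (1/2 − τ(x,i)) = n/2 − k_x`).
Theory seat memo ROTOR-THEORY-6 §72; Tasaki (2020) §2.1. [folklore] -/
theorem fibreZ_mul_blowUpIso (n : ℕ) (x : V) :
    ((∑ i : Fin n, (onSite (x, i) (SpinOperators.spinZ 1) : Matrix (V × Fin n → Fin 2) (V × Fin n → Fin 2) ℂ)) * (blowUpIso n : Matrix (V × Fin n → Fin 2) (V → Fin (n + 1)) ℂ) : Matrix (V × Fin n → Fin 2) (V → Fin (n + 1)) ℂ) =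
      ((blowUpIso n : Matrix (V × Fin n → Fin 2) (V → Fin (n + 1)) ℂ) * (onSite x (SpinOperators.spinZ n) : Matrix (V → Fin (n + 1)) (V → Fin (n + 1)) ℂ) : Matrix (V × Fin n → Fin 2) (V → Fin (n + 1)) ℂ) := by
  ext τ k
  rw [Matrix.sum_mul, Matrix.sum_apply]
  have hL : ∀ i : Fin n, ((onSite (x, i) (SpinOperators.spinZ 1) : Matrix (V × Fin n → Fin 2) (V × Fin n → Fin 2) ℂ) * (blowUpIso n : Matrix (V × Fin n → Fin 2) (V → Fin (n + 1)) ℂ) : Matrix (V × Fin n → Fin 2) (V → Fin (n + 1)) ℂ) τ k =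
      ((1 : ℂ) / 2 - ((τ (x, i) : ℕ) : ℂ)) * blowUpIso n τ k := by
    intro i
    rw [SpinOperators.spinZ, LiebMattis.onSite_diagonal, Matrix.diagonal_mul]
    norm_num
  simp_rw [hL]
  rw [← Finset.sum_mul]
  set c := blowUpCount n τ with hc
  have hR : ((blowUpIso n : Matrix (V × Fin n → Fin 2) (V → Fin (n + 1)) ℂ) * (onSite x (SpinOperators.spinZ n) : Matrix (V → Fin (n + 1)) (V → Fin (n + 1)) ℂ) : Matrix (V × Fin n → Fin 2) (V → Fin (n + 1)) ℂ) τ k =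
      blowUpIso n τ k * (((n : ℂ)) / 2 - ((c x : ℕ) : ℂ)) := by
    rw [SpinOperators.spinZ, LiebMattis.onSite_diagonal, Matrix.mul_diagonal, blowUpIso_apply]
    split_ifs with h
    · rw [hc, h]
    · rw [zero_mul, zero_mul]
  rw [hR, mul_comm]
  by_cases hk : blowUpCount n τ = k
  · congr 1
    -- `Σ_i (1/2 − τ(x,i)) = n/2 − c_x`
    have hsum : (∑ i : Fin n, ((τ (x, i) : ℕ) : ℂ)) = ((c x : ℕ) : ℂ) := by
      rw [hc, blowUpCount_apply_val, Finset.card_filter]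
      push_cast
      refine Finset.sum_congr rfl fun i _ => ?_
      rcases Fin.exists_fin_two.mp ⟨τ (x, i), rfl⟩ with h | h <;> simp [h]
    rw [Finset.sum_sub_distrib, hsum, Finset.sum_const, Finset.card_univ, Fintype.card_fin, nsmul_eq_mul]
    ring
  · rw [blowUpIso_apply, if_neg hk, zero_mul, zero_mul]

end Summit.HubbardSuperconductivity.HubbardSuperconductivity.Theorems.AnisotropyChord
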